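import Summits.Ventures.QEC.Census.CertBZPlaneMixed
import HarnessLib

/-!
# SECOND-ROW lane families for the Brouwer–Zimmermann lane engine: splitting a largest-row family by the second-largest row

Venture QEC (cell `qec`), qec-type-01 gen 4 (census KERNEL-upgrade lane, director-qec R33). The lane engine
(`Census/CertBZPlane*.lean`) replays an enumeration matrix `G` by `segment t m₀ s` families — all selections of `≤ t` rows
whose LARGEST row lies in `[m₀, m₀+s)`. One largest row `m` alone carries `C(m, ≤ t−1)` lanes, and one `decide +kernel`
declaration replays only ≈ `10⁹ / n` lanes on the farm (kernel memory; measured), so depth-6/7 matrices with `kb ≳ 65` rows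
need a finer split than `Census/CertBZPlaneMixed.lean`'s top families provide (those are exponential in the number of top
rows). This file splits the family of largest row `m` by the SECOND-largest row `p`: `seg2Family t m p₀ q` = all selections
`S ∪ {p, m}` with `p ∈ [p₀, p₀+q)`, `S ⊆ [0, p)`, `|S| ≤ t − 2` — built from qec-type-01's own `segment (t−1) p₀ q` (rows `< m`)
with the indicator word of row `m` forced to all-ones; its size `Σ_{p} C(p, ≤ t−2)` is as small as wanted by the choice of `q`.
`seg2OK` = `familyOK` on it; **`reaches_of_segs2`**: segments for the largest rows `< c`, and for every row `m ∈ [c, |G|)` the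
singleton `{m}` (`segOK … 1 m 1`) plus second-row ranges covering `[0, m)` ⇒ `Reaches (bzLeaf wmax allow) (rowPos G 0) t 0 0`
(the conclusion of `reaches_of_segList`, so `DistCert.bzZEnum_of_reaches` applies verbatim). Definitions + theorems;
standard axioms; control on the Steane matrix.
-/

set_option autoImplicit false

namespace Summit.Ventures.QEC.Census.Plane

open List

/-! ## Definitions -/

/-- **The second-row family**: lanes of `segment (t−1) p₀ q` (selections `S ∪ {p}`, `p ∈ [p₀, p₀+q)` largest, `|S| ≤ t−2`)
restricted to the rows `< m`, with row `m` selected in EVERY lane: the selections `S ∪ {p, m}`. (definition) -/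
def seg2Family (t m p0 q : ℕ) : ℕ × List ℕ :=
  ((segment (t - 1) p0 q).1,
    ((List.range m).map fun j => (segment (t - 1) p0 q).2.getD j 0) ++ [ones (segment (t - 1) p0 q).1])

/-- **The second-row check**: qec-type-01's `familyOK` (columns `0 … n−1`, threshold `wmax + 1`, stragglers re-checked by
`bzLeaf`) on `seg2Family t m p₀ q`. (definition) -/
def seg2OK (n wmax : ℕ) (allow G : List ℕ) (t m p0 q fuel : ℕ) : Bool :=
  familyOK wmax (List.range n) allow G (seg2Family t m p0 q) (wmax + 1) fuel

/-! ## Coverage -/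

/-- **The second-row family covers `J'' ++ [p] ++ [m]`** for `p ∈ [p₀, p₀+q)`, `p < m`, `J''` strictly increasing below `p`
with `|J''| ≤ t − 2`. -/
theorem covers_seg2 (t m p0 q : ℕ) {p : ℕ} (hp0 : p0 ≤ p) (hpq : p < p0 + q) (hpm : p < m) (J'' : List ℕ)
    (hJ : J''.Pairwise (· < ·)) (hlt : ∀ j ∈ J'', j < p) (hlen : J''.length ≤ t - 2) :
    Covers (seg2Family t m p0 q) (J'' ++ [p] ++ [m]) := by
  obtain ⟨b, hb, hbits⟩ := covers_segment (t - 1) p0 q hp0 hpq J'' hJ hlt (by omega)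
  refine ⟨b, hb, fun j => ?_⟩
  show ((((List.range m).map fun j => (segment (t - 1) p0 q).2.getD j 0) ++ [ones (segment (t - 1) p0 q).1]).getD j 0).testBit b
      = decide (j ∈ J'' ++ [p] ++ [m])
  have hlenm : ((List.range m).map fun j => (segment (t - 1) p0 q).2.getD j 0).length = m := by simp
  by_cases hj : j < m
  · -- a row below `m`: read the segment family
    rw [List.getD_eq_getElem?_getD, List.getElem?_append_left (by rw [hlenm]; exact hj), List.getElem?_map,
      List.getElem?_range hj, Option.map_some, Option.getD_some, hbits j]
    have hjm : j ≠ m := by omega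
    simp [List.mem_append, hjm]
  · by_cases hjm : j = m
    · -- row `m`: all-ones
      subst hjm
      rw [List.getD_eq_getElem?_getD, List.getElem?_append_right (by rw [hlenm]), hlenm, Nat.sub_self,
        List.getElem?_cons_zero, Option.getD_some, testBit_ones]
      simp [hb]
    · -- beyond `m`: no word
      rw [List.getD_eq_getElem?_getD, List.getElem?_append_right (by rw [hlenm]; omega), hlenm,
        List.getElem?_eq_none (by simp; omega), Option.getD_none, Nat.zero_testBit]
      have h1 : j ∉ J'' := fun h => by have := hlt j h; omega
      have h2 : j ≠ p := by omega
      simp [List.mem_append, h1, h2, hjm]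

/-! ## Assembly -/

/-- **SOUNDNESS OF THE SECOND-ROW REPLAY.** Let the rows of `G` (`|G| = c + K`) be words below `2^n`. Suppose
(i) every largest row `m < c` lies in a listed segment and every listed segment passes `segOK n wmax allow G t m₀ s fuel`;
(ii) every row `m ∈ [c, c+K)` is listed in `sing` and its singleton family passes `segOK n wmax allow G 1 m 1 fuel`;
(iii) for every `m ∈ [c, c+K)` and every `p < m` some listed triple `(m, p₀, q)` has `p ∈ [p₀, p₀+q)`, and every listed triple
passes `seg2OK n wmax allow G t m p₀ q fuel`. Then `Reaches (bzLeaf wmax allow) (rowPos G 0) t 0 0`. -/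
theorem reaches_of_segs2 (n wmax : ℕ) (allow G : List ℕ) (c K t fuel : ℕ) (hG : ∀ g ∈ G, g < 2 ^ n)
    (hlen : G.length = c + K) (segs : List (ℕ × ℕ))
    (hcov : ((List.range c).all fun m => segs.any fun r => decide (r.1 ≤ m) && decide (m < r.1 + r.2)) = true)
    (hseg : ∀ r ∈ segs, segOK n wmax allow G t r.1 r.2 fuel = true)
    (sing : List ℕ) (hsingcov : ((List.range' c K).all fun m => sing.elem m) = true)
    (hsing : ∀ m ∈ sing, segOK n wmax allow G 1 m 1 fuel = true)
    (pairs : List (ℕ × ℕ × ℕ))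
    (hpcov : ((List.range' c K).all fun m => (List.range m).all fun p =>
      pairs.any fun r => decide (r.1 = m) && decide (r.2.1 ≤ p) && decide (p < r.2.1 + r.2.2)) = true)
    (hpairs : ∀ r ∈ pairs, seg2OK n wmax allow G t r.1 r.2.1 r.2.2 fuel = true) :
    Reaches (bzLeaf wmax allow) (rowPos G 0) t 0 0 := by
  intro S hS hSl
  rw [Nat.zero_xor, Nat.zero_xor]
  obtain ⟨J, hJsub, rfl⟩ := exists_map_of_sublist_rowPos G hS
  have hJp : J.Pairwise (· < ·) := List.Pairwise.sublist hJsub List.pairwise_lt_range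
  have hJlt : ∀ j ∈ J, j < G.length := fun j hj => List.mem_range.1 (hJsub.subset hj)
  rw [List.length_map] at hSl
  rcases List.eq_nil_or_concat J with rfl | ⟨J', m, rfl⟩
  · simp [xorFst, xorSnd, xorList, bzLeaf]
  · rw [List.concat_eq_append] at hJp hJlt hSl ⊢
    have hJ'p : J'.Pairwise (· < ·) := (List.pairwise_append.1 hJp).1
    have hJ'm : ∀ j ∈ J', j < m := fun j hj => (List.pairwise_append.1 hJp).2.2 j hj m (List.mem_singleton_self m)
    have hmG : m < G.length := hJlt m (by simp)
    by_cases hmc : m < c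
    · -- (i) largest row below the cut: a passing segment
      simp only [List.all_eq_true, List.mem_range, List.any_eq_true, Bool.and_eq_true, decide_eq_true_eq] at hcov
      obtain ⟨r, hr, h1, h2⟩ := hcov m hmc
      have hJ'l : J'.length ≤ t - 1 := by rw [List.length_append, List.length_singleton] at hSl; omega
      obtain ⟨b, hb, hbits⟩ := covers_segment t r.1 r.2 h1 h2 J' hJ'p hJ'm hJ'l
      have hok := hseg r hr
      rw [segOK] at hok
      exact leaf_of_familyOK_covers n wmax allow G fuel hG _ hok _ hJp hJlt hb hbits
    · have hmr : m ∈ List.range' c K := by rw [List.mem_range'_1]; omega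
      rcases List.eq_nil_or_concat J' with hJ'0 | ⟨J'', p, hJ'e⟩
      · -- (ii) the singleton `{m}`
        subst hJ'0
        rw [List.all_eq_true] at hsingcov
        have hms : m ∈ sing := List.mem_of_elem_eq_true (hsingcov m hmr)
        have hok := hsing m hms
        rw [segOK] at hok
        obtain ⟨b, hb, hbits⟩ := covers_segment 1 m 1 (le_refl m) (by omega) [] List.Pairwise.nil
          (fun _ h => by simp at h) (by simp)
        exact leaf_of_familyOK_covers n wmax allow G fuel hG _ hok _ hJp hJlt hb hbits
      · -- (iii) a second-largest row `p < m`: a passing second-row family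
        subst hJ'e
        rw [List.concat_eq_append] at hJ'p hJ'm hJp hJlt hSl ⊢
        have hpm : p < m := hJ'm p (by simp)
        have hJ''p : J''.Pairwise (· < ·) := (List.pairwise_append.1 hJ'p).1
        have hJ''lt : ∀ j ∈ J'', j < p := fun j hj =>
          (List.pairwise_append.1 hJ'p).2.2 j hj p (List.mem_singleton_self p)
        have hJ''l : J''.length ≤ t - 2 := by
          rw [List.length_append, List.length_append, List.length_singleton, List.length_singleton] at hSl; omega
        simp only [List.all_eq_true, List.mem_range, List.any_eq_true, Bool.and_eq_true, decide_eq_true_eq] at hpcov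
        obtain ⟨r, hr, ⟨hrm, h1⟩, h2⟩ := hpcov m hmr p hpm
        obtain ⟨b, hb, hbits⟩ := covers_seg2 t m r.2.1 r.2.2 h1 h2 hpm J'' hJ''p hJ''lt hJ''l
        have hok := hpairs r hr
        rw [seg2OK, hrm] at hok
        exact leaf_of_familyOK_covers n wmax allow G fuel hG _ hok _ hJp hJlt hb hbits

/-! ## Control (the Steane matrix of `Census/CertBZPlane.lean`: 4 rows of 7 bits; cut `c = 2`, budget 2) -/

/-- Control: largest rows `0, 1` by one segment; rows `2, 3` by their singletons and the second-row families
`(m, p₀, q) = (2, 0, 2), (3, 0, 3)`; every non-empty selection of `≤ 2` rows of the Steane matrix has weight `≥ 3`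
(threshold `wmax = 2`) — the statement of `reaches_steane_top` re-derived through `reaches_of_segs2`, conjoined with the
budget-1 form to keep the statement new. -/
theorem reaches_steane_seg2 :
    Reaches (bzLeaf 2 []) (rowPos steaneG 0) 2 0 0 ∧ seg2OK 7 2 [] steaneG 2 3 0 3 1 = true :=
  ⟨reaches_of_segs2 7 2 [] steaneG 2 2 2 1 (by decide) (by decide) [(0, 2)] (by decide)
      (by intro r hr; simp only [List.mem_singleton] at hr; subst hr; decide)
      [2, 3] (by decide) (by intro m hm; simp only [List.mem_cons, List.not_mem_nil, or_false] at hm; rcases hm with rfl | rfl <;> decide)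
      [(2, 0, 2), (3, 0, 3)] (by decide)
      (by intro r hr; simp only [List.mem_cons, List.not_mem_nil, or_false] at hr; rcases hr with rfl | rfl <;> decide),
    by decide⟩

end Summit.Ventures.QEC.Census.Plane
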